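import Summits.AnomalousDissipation.AnomalousDissipation.Theorems.QuarticGate.Negative.EnergyRow
import Summits.AnomalousDissipation.AnomalousDissipation.Theorems.QuarticGate.Negative.MomentumRow
import Literature.Analysis.FluidPDE.CylindricalGenerator
import Literature.Analysis.FunctionSpaces.TorusFourierSeries
import Literature.Analysis.FunctionSpaces.TorusTruncationH1
import Literature.Analysis.FunctionSpaces.TorusFluidGlueProofs

/-!
# Stub `stub_energyFloor` of the line `taylor-cone-homogenisation`
# (crux stmt-AnomalousDissipation-14283, `MomentParity.GalerkinInvariantLoud`)

**Energy floor from the linear row.** For every smooth divergence-free mean-zero force `f ≠ 0` there are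
`e₀, ν₀ > 0` and a level `N₀` such that at every viscosity `0 < ν ≤ ν₀` and every level `N ≥ N₀`, every
probability law on `H` with finite mean energy whose linear rows vanish (`IsPolyStationary ν f N 2 μ`) has
mean energy `∫|u|²dμ ≥ e₀`.

Proof. Test the degree-one observable `(u, P_N f)` (`m = 1`, `g₀ = P_N f := Torus.fourierTruncate N f`,
`P = X₀`; `P_N f` is a level-`N` band test). Its row, integrated against `μ`, reads
`∫‖P_N f‖² + ν ∫ (u, ΔP_N f) dμ + ∫ ((u ⊗ u) : ∇P_N f) dμ = 0`, and
`|∫(u, ΔP_N f)dμ| ≤ ‖ΔP_N f‖₂ √e ≤ ‖Δf‖₂ √e` (Cauchy–Schwarz, Jensen, Bessel),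
`|(u ⊗ u) : ∇P_N f| ≤ G |u|²` with `G = sup Σᵢ‖∂ᵢf‖ + Σᵢ Σₖ ‖(∂ᵢ f)^(k)‖` UNIFORM in `N`
(`∂ᵢ P_N f = P_N ∂ᵢ f` and the absolutely summable Fourier series of `∂ᵢ f`), while
`∫‖P_N f‖² → ∫‖f‖² =: F > 0` (Parseval), so `∫‖P_N f‖² > F/2` for `N ≥ N₀`. With
`e₀ := min 1 (F / (4(G+1)))`, `ν₀ := F / (4(‖Δf‖₂ + 1))`, a law with `e < e₀` would give
`F/2 < ν‖Δf‖₂√e + G e < F/4 + F/4`.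

The row bookkeeping (`integral_inner_le_of_row`) is adapted from §5 `exists_energyFloor` of the refuter's work
file `Cruxes/GalerkinInvariantLoud/Disproof.lean` (refuter-cdisprove-stmt-AnomalousDissipation-14283-0), which
treats the band-limited case; the truncation bookkeeping and the threshold form are new here. All of it is
folklore (mean momentum balance tested on the force).
-/

-- `Summit.<Summit>.<Problem>` is the tree's mandated summit-side namespace (CONVENTIONS §2); for this
-- single-conjunct summit the two coincide, so the duplicate is deliberate.
set_option linter.dupNamespace false

noncomputable section

namespace Summit.AnomalousDissipation.AnomalousDissipation.Theorems.GalerkinInvariantLoud.EnergyFloor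

open MeasureTheory Filter Topology Set
open scoped ENNReal InnerProductSpace RealInnerProductSpace
open Literature.Analysis.FunctionSpaces Literature.Analysis.FluidPDE
open Summit.AnomalousDissipation.AnomalousDissipation.Theses.MomentParity
open Summit.AnomalousDissipation.AnomalousDissipation.Theorems.QuarticGate.Negative

/-! ## The linear observable `(u, g₀)` and the truncated force as a band test -/

-- `∇p(u) = g₀` for the linear observable `p(u) = (u, g₀)` is the landed `QuarticGate.Negative.polyGrad_X`
-- (MomentumRow.lean); used below in `stub_energyFloor`.

/-- The truncation `P_N f` of a smooth divergence-free mean-zero force is a level-`N` band test: a trigonometric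
polynomial, divergence-free, mean-zero, carried by `0 < |k|² ≤ N²`. [folklore] -/
theorem isBandTest_fourierTruncate {f : UnitAddTorus (Fin 3) → EuclideanSpace ℝ (Fin 3)}
    (hfs : Torus.IsSmooth f) (hfd : Torus.IsDivFree f) (hfz : Torus.HasZeroMean f) (N : ℕ) :
    IsBandTest N (Torus.fourierTruncate N f) :=
  ⟨Torus.isSmooth_fourierTruncate N f,
    Torus.isDivFree_fourierTruncate (hfs.memLp 2) (hfd.isWeaklyDivFree_holds hfs) N,
    Torus.hasZeroMean_fourierTruncate hfs.integrable hfz N,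
    fun _ hk => Torus.mFourierCoeff_fourierTruncate_eq_zero_of_not_mem_erase hfs.integrable hfz N hk⟩

/-! ## Bounds on the truncations, uniform in the level -/

/-- **Uniform-in-`N` bound on the first derivatives of the truncations** of a smooth field:
`∑ᵢ ‖∂ᵢ P_N f(x)‖ ≤ G` with `G = sup ∑ᵢ‖∂ᵢ f‖ + ∑ᵢ ∑ₖ ‖(∂ᵢ f)^(k)‖` (`∂ᵢ P_N f = P_N ∂ᵢ f`, and the Fourier
series of `∂ᵢ f` converges absolutely; the truncation is no `L∞` contraction, so `sup ∑ᵢ‖∂ᵢ f‖` alone would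
not do). [folklore] -/
theorem exists_sum_norm_partialDeriv_fourierTruncate_le
    {f : UnitAddTorus (Fin 3) → EuclideanSpace ℝ (Fin 3)} (hfs : Torus.IsSmooth f) :
    ∃ G : ℝ, 0 ≤ G ∧ ∀ (N : ℕ) (x : UnitAddTorus (Fin 3)),
      ∑ i, ‖Torus.partialDeriv i (Torus.fourierTruncate N f) x‖ ≤ G := by
  obtain ⟨C, hC0, hC⟩ := Torus.exists_sum_norm_partialDeriv_le hfs
  set S : Fin 3 → ℝ := fun i => ∑' k : Fin 3 → ℤ,
    ‖UnitAddTorus.mFourierCoeff (EuclideanSpace.complexify ∘ Torus.partialDeriv i f) k‖ with hS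
  have hS0 : ∀ i, 0 ≤ S i := fun i => tsum_nonneg fun _ => norm_nonneg _
  refine ⟨C + ∑ i, S i, add_nonneg hC0 (Finset.sum_nonneg fun i _ => hS0 i), fun N x => ?_⟩
  have hi : ∀ i, ‖Torus.partialDeriv i (Torus.fourierTruncate N f) x‖ ≤
      ‖Torus.partialDeriv i f x‖ + S i := fun i => by
    rw [Torus.partialDeriv_fourierTruncate hfs N i x]
    refine (Torus.norm_fourierTruncate_apply_le (hfs.partialDeriv i) N x).trans (add_le_add le_rfl ?_)
    exact (Torus.summable_norm_mFourierCoeff_of_isSmooth (hfs.partialDeriv i)).tsum_subtype_le _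
      {k : Fin 3 → ℤ | k ∉ Torus.freqBall N} fun _ => norm_nonneg _
  calc ∑ i, ‖Torus.partialDeriv i (Torus.fourierTruncate N f) x‖
      ≤ ∑ i, (‖Torus.partialDeriv i f x‖ + S i) := Finset.sum_le_sum fun i _ => hi i
    _ = (∑ i, ‖Torus.partialDeriv i f x‖) + ∑ i, S i := Finset.sum_add_distrib
    _ ≤ C + ∑ i, S i := add_le_add (hC x) le_rfl

/-- **Uniform-in-`N` `L²` bound on the Laplacian of the truncations**: `∫‖ΔP_N f‖² ≤ ∫‖Δf‖²`
(`ΔP_N f = P_N Δf` and Bessel). [folklore] -/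
theorem integral_norm_sq_laplacian_fourierTruncate_le
    {f : UnitAddTorus (Fin 3) → EuclideanSpace ℝ (Fin 3)} (hfs : Torus.IsSmooth f) (N : ℕ) :
    ∫ x, ‖Torus.laplacian (Torus.fourierTruncate N f) x‖ ^ 2 ≤ ∫ x, ‖Torus.laplacian f x‖ ^ 2 := by
  have h : Torus.laplacian (Torus.fourierTruncate N f) = Torus.fourierTruncate N (Torus.laplacian f) :=
    funext fun x => Torus.laplacian_fourierTruncate hfs N x
  rw [h]
  exact Torus.integral_norm_sq_fourierTruncate_le (hfs.laplacian.memLp 2) N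

/-- `∫⟪f, P_N f⟫ = ∫‖P_N f‖²`: the truncation is invisible to the band-limited field `P_N f`. [folklore] -/
theorem integral_inner_fourierTruncate_self
    {f : UnitAddTorus (Fin 3) → EuclideanSpace ℝ (Fin 3)} (hfs : Torus.IsSmooth f) (N : ℕ) :
    ∫ x, ⟪f x, Torus.fourierTruncate N f x⟫_ℝ = ∫ x, ‖Torus.fourierTruncate N f x‖ ^ 2 := by
  rw [← Torus.integral_inner_fourierTruncate_eq (hfs.memLp 2) (Torus.memLp_fourierTruncate N f 2)
    (fun k hk => ?_)]
  · exact integral_congr_ae (ae_of_all _ fun x => real_inner_self_eq_norm_sq _)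
  · rw [Torus.mFourierCoeff_fourierTruncate hfs.integrable, if_neg hk]

/-- **`∫‖P_N f‖² → ∫‖f‖²`** (Parseval: `∫‖P_N f‖² = ∑_{|k| ≤ N} ‖f̂ k‖²` and the balls exhaust `ℤ³`).
[folklore] -/
theorem tendsto_integral_norm_sq_fourierTruncate
    {f : UnitAddTorus (Fin 3) → EuclideanSpace ℝ (Fin 3)} (hfs : Torus.IsSmooth f) :
    Tendsto (fun N => ∫ x, ‖Torus.fourierTruncate N f x‖ ^ 2) atTop (𝓝 (∫ x, ‖f x‖ ^ 2)) := by
  have h : Tendsto (fun s : Finset (Fin 3 → ℤ) => ∑ k ∈ s,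
      ‖UnitAddTorus.mFourierCoeff (EuclideanSpace.complexify ∘ f) k‖ ^ 2) atTop
      (𝓝 (∫ x, ‖f x‖ ^ 2)) :=
    Torus.hasSum_sq_norm_mFourierCoeff_complexify (hfs.memLp 2)
  refine (h.comp Torus.tendsto_freqBall_atTop).congr fun N => ?_
  rw [Function.comp_apply, Torus.integral_norm_sq_fourierTruncate hfs.integrable]

/-- A smooth field which does not vanish identically has `0 < ∫‖f‖²` (a continuous non-negative function with
zero integral vanishes, the Haar measure of the torus charging open sets). [folklore] -/
theorem integral_norm_sq_pos_of_isSmooth {f : UnitAddTorus (Fin 3) → EuclideanSpace ℝ (Fin 3)}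
    (hfs : Torus.IsSmooth f) (hf0 : f ≠ 0) : 0 < ∫ x, ‖f x‖ ^ 2 := by
  have hint : Integrable (fun x => ‖f x‖ ^ 2) volume :=
    (memLp_two_iff_integrable_sq_norm (hfs.memLp 2).1).1 (hfs.memLp 2)
  refine lt_of_le_of_ne (integral_nonneg fun x => by positivity) fun h => hf0 ?_
  have hae := (integral_eq_zero_iff_of_nonneg (f := fun x => ‖f x‖ ^ 2) (fun x => by positivity)
    hint).1 h.symm
  have heq : (fun x => ‖f x‖ ^ 2) = fun _ => (0 : ℝ) :=
    (Continuous.ae_eq_iff_eq volume (hfs.continuous.norm.pow 2) continuous_const).1 hae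
  funext x
  have hx := congrFun heq x
  simpa using hx

/-! ## The linear row, integrated -/

/-- **The linear row, integrated** (adapted from `Cruxes/GalerkinInvariantLoud/Disproof.lean` §5
`exists_energyFloor`). If the row of the linear observable `(u, g)` has zero mean on a probability law `μ` on
`H` with finite mean energy `e = ∫|u|²dμ`, `g` smooth with `∑ᵢ‖∂ᵢ g‖ ≤ G` and `0 ≤ ν`, then
`∫⟪f, g⟫ ≤ ν ‖Δg‖₂ √e + G e`: the row is `∫⟪f,g⟫ + ν(u, Δg) + ∫(u ⊗ u):∇g`, with
`|(u, Δg)| ≤ |u| ‖Δg‖₂` (Cauchy–Schwarz), `∫|u|dμ ≤ √e` (Jensen) and `|∫(u ⊗ u):∇g| ≤ G|u|²`. [folklore] -/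
theorem integral_inner_le_of_row {ν : ℝ} (hν : 0 ≤ ν)
    {f g : UnitAddTorus (Fin 3) → EuclideanSpace ℝ (Fin 3)} (hg : Torus.IsSmooth g)
    {G : ℝ} (hG : ∀ x, ∑ i, ‖Torus.partialDeriv i g x‖ ≤ G)
    {μ : Measure (Torus.energySpace (Fin 3))} [IsProbabilityMeasure μ]
    (h2 : Integrable (fun u : Torus.energySpace (Fin 3) => ‖u‖ ^ 2) μ)
    (hrow : ∫ u, Torus.nsGeneratorPairing ν f u g ∂μ = 0) :
    ∫ x, ⟪f x, g x⟫_ℝ ≤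
      ν * Real.sqrt (∫ x, ‖Torus.laplacian g x‖ ^ 2) * Real.sqrt (Torus.ensembleEnergy μ) +
        G * Torus.ensembleEnergy μ := by
  -- adapted from Cruxes/GalerkinInvariantLoud/Disproof.lean §5 `exists_energyFloor`
  -- (refuter-cdisprove-stmt-AnomalousDissipation-14283-0)
  have hΔ : MemLp (Torus.laplacian g) 2 volume := hg.laplacian.memLp 2
  -- the two `u`-dependent summands of the row
  set P : Torus.energySpace (Fin 3) → ℝ := fun u => Torus.pairing u.1 (Torus.laplacian g) with hPdef
  set Q : Torus.energySpace (Fin 3) → ℝ := fun u =>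
    Torus.inertialPairing (u : Lp (EuclideanSpace ℝ (Fin 3)) 2 (volume : Measure (UnitAddTorus (Fin 3)))) g
    with hQdef
  have hexp : ∀ u : Torus.energySpace (Fin 3),
      Torus.nsGeneratorPairing ν f u g = (∫ x, ⟪f x, g x⟫_ℝ) + ν * P u + Q u := fun u => rfl
  have h1 : Integrable (fun u : Torus.energySpace (Fin 3) => ‖u‖) μ := integrable_norm_of_norm_sq h2
  have hPint : Integrable P μ := CubicParityLoud.Negative.integrable_pairing hΔ h1
  have hQbd : ∀ u : Torus.energySpace (Fin 3), |Q u| ≤ G * ‖u‖ ^ 2 := fun u => by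
    have h := (Torus.integrable_inner_fderiv_apply_coe hg hG
      (u : Lp (EuclideanSpace ℝ (Fin 3)) 2 (volume : Measure (UnitAddTorus (Fin 3))))
      (u : Lp (EuclideanSpace ℝ (Fin 3)) 2 (volume : Measure (UnitAddTorus (Fin 3))))).2
    rw [hQdef]
    dsimp only
    rw [Torus.inertialPairing, sq]
    exact h
  have hQint : Integrable Q μ :=
    Integrable.mono' (h2.const_mul G) (Torus.continuous_inertialPairing_coe hg).aestronglyMeasurable
      (ae_of_all _ fun u => by rw [Real.norm_eq_abs]; exact hQbd u)
  -- integrate the row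
  have h12' : Integrable (fun u : Torus.energySpace (Fin 3) => ν * P u) μ := hPint.const_mul ν
  have h12 : Integrable (fun u : Torus.energySpace (Fin 3) => (∫ x, ⟪f x, g x⟫_ℝ) + ν * P u) μ :=
    (integrable_const _).add h12'
  have hsum : (∫ x, ⟪f x, g x⟫_ℝ) + ν * (∫ u, P u ∂μ) + ∫ u, Q u ∂μ = 0 := by
    have h := hrow
    simp_rw [hexp] at h
    rw [integral_add h12 hQint, integral_add (integrable_const _) h12', integral_const_mul, integral_const,
      smul_eq_mul, probReal_univ, one_mul] at h
    exact h
  -- bounds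
  have hPb : |∫ u, P u ∂μ| ≤ ‖hΔ.toLp (Torus.laplacian g)‖ * Real.sqrt (Torus.ensembleEnergy μ) := by
    calc |∫ u, P u ∂μ| ≤ ∫ u, |P u| ∂μ := abs_integral_le_integral_abs
      _ ≤ ∫ u, ‖u‖ * ‖hΔ.toLp (Torus.laplacian g)‖ ∂μ :=
          integral_mono hPint.abs (h1.mul_const _) fun u => Torus.abs_pairing_coe_le hΔ u
      _ = (∫ u, ‖u‖ ∂μ) * ‖hΔ.toLp (Torus.laplacian g)‖ := integral_mul_const _ _
      _ ≤ Real.sqrt (Torus.ensembleEnergy μ) * ‖hΔ.toLp (Torus.laplacian g)‖ := by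
          refine mul_le_mul_of_nonneg_right ?_ (norm_nonneg _)
          exact (le_abs_self _).trans (Real.abs_le_sqrt (CubicParityLoud.Negative.sq_integral_norm_le h2))
      _ = ‖hΔ.toLp (Torus.laplacian g)‖ * Real.sqrt (Torus.ensembleEnergy μ) := mul_comm _ _
  have hQb : |∫ u, Q u ∂μ| ≤ G * Torus.ensembleEnergy μ := by
    calc |∫ u, Q u ∂μ| ≤ ∫ u, |Q u| ∂μ := abs_integral_le_integral_abs
      _ ≤ ∫ u, G * ‖u‖ ^ 2 ∂μ := integral_mono hQint.abs (h2.const_mul G) hQbd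
      _ = G * Torus.ensembleEnergy μ := by rw [integral_const_mul]; rfl
  rw [CubicParityLoud.Negative.norm_toLp_eq_sqrt] at hPb
  have hνP : |ν * ∫ u, P u ∂μ| ≤
      ν * (Real.sqrt (∫ x, ‖Torus.laplacian g x‖ ^ 2) * Real.sqrt (Torus.ensembleEnergy μ)) := by
    rw [abs_mul, abs_of_nonneg hν]
    exact mul_le_mul_of_nonneg_left hPb hν
  have key : ∫ x, ⟪f x, g x⟫_ℝ = -(ν * ∫ u, P u ∂μ) - ∫ u, Q u ∂μ := by linarith
  rw [key]
  linarith [neg_abs_le (ν * ∫ u, P u ∂μ), neg_abs_le (∫ u, Q u ∂μ)]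

/-! ## The registered stub -/

/-- **Stub `stub_energyFloor` (S1) — ENERGY FLOOR from the linear row (threshold form).**
For every smooth divergence-free mean-zero force `f ≠ 0` there are `e₀, ν₀ > 0` and a level `N₀` such that
at every viscosity `0 < ν ≤ ν₀` and every level `N ≥ N₀`, EVERY level-`N` probability law with finite mean
energy whose LINEAR rows vanish (`IsPolyStationary ν f N 2 μ`) has mean energy `∫|u|²dμ ≥ e₀`.
Test the degree-one observable `(u, P_N f)`: its row gives `∫‖P_N f‖² ≤ ν‖Δf‖₂√e + G e` with `G`
uniform in `N` (`exists_sum_norm_partialDeriv_fourierTruncate_le`), while `∫‖P_N f‖² > ∫‖f‖²/2` for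
`N ≥ N₀`; `e₀ := min 1 (F/(4(G+1)))`, `ν₀ := F/(4(‖Δf‖₂+1))`, `F := ∫‖f‖²`. The level clause is not used.
[folklore] -/
theorem stub_energyFloor :
    ∀ f : UnitAddTorus (Fin 3) → EuclideanSpace ℝ (Fin 3),
      Torus.IsSmooth f → Torus.IsDivFree f → Torus.HasZeroMean f → f ≠ 0 →
      ∃ e₀ ν₀ : ℝ, 0 < e₀ ∧ 0 < ν₀ ∧ ∃ N₀ : ℕ, ∀ ν : ℝ, 0 < ν → ν ≤ ν₀ → ∀ N : ℕ, N₀ ≤ N →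
        ∀ μ : Measure (Torus.energySpace (Fin 3)), IsProbabilityMeasure μ →
          (∀ᵐ u ∂μ, IsLevel N u) →
          Integrable (fun u : Torus.energySpace (Fin 3) => ‖u‖ ^ 2) μ →
          IsPolyStationary ν f N 2 μ →
          e₀ ≤ Torus.ensembleEnergy μ := by
  intro f hfs hfd hfz hf0
  -- the constants of the force
  set F : ℝ := ∫ x, ‖f x‖ ^ 2 with hFdef
  have hF : 0 < F := integral_norm_sq_pos_of_isSmooth hfs hf0
  obtain ⟨G, hG0, hG⟩ := exists_sum_norm_partialDeriv_fourierTruncate_le hfs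
  set L : ℝ := Real.sqrt (∫ x, ‖Torus.laplacian f x‖ ^ 2) with hLdef
  have hL0 : 0 ≤ L := Real.sqrt_nonneg _
  -- the level threshold: `∫‖P_N f‖² > F/2` for `N ≥ N₀`
  obtain ⟨N₀, hN₀⟩ : ∃ N₀ : ℕ, ∀ N, N₀ ≤ N → F / 2 < ∫ x, ‖Torus.fourierTruncate N f x‖ ^ 2 :=
    eventually_atTop.1 ((tendsto_integral_norm_sq_fourierTruncate hfs).eventually
      (lt_mem_nhds (by linarith)))
  refine ⟨min 1 (F / (4 * (G + 1))), F / (4 * (L + 1)), lt_min one_pos (by positivity),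
    by positivity, N₀, ?_⟩
  intro ν hν hνν₀ N hN μ hμ _ h2 hst
  -- the linear row of `(u, P_N f)`
  obtain ⟨-, hG0row⟩ := hst 1 (fun _ => Torus.fourierTruncate N f) (MvPolynomial.X 0)
    (fun _ => isBandTest_fourierTruncate hfs hfd hfz N) (by simp)
  simp_rw [polyGrad_X] at hG0row
  have hrow := integral_inner_le_of_row hν.le (Torus.isSmooth_fourierTruncate N f) (hG N) h2 hG0row
  rw [integral_inner_fourierTruncate_self hfs N] at hrow
  have hFN : F / 2 < ∫ x, ‖Torus.fourierTruncate N f x‖ ^ 2 := hN₀ N hN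
  have hsqrtL : Real.sqrt (∫ x, ‖Torus.laplacian (Torus.fourierTruncate N f) x‖ ^ 2) ≤ L :=
    Real.sqrt_le_sqrt (integral_norm_sq_laplacian_fourierTruncate_le hfs N)
  -- suppose `e < e₀`
  by_contra hlt
  rw [not_le] at hlt
  have he1 : Torus.ensembleEnergy μ < 1 := hlt.trans_le (min_le_left _ _)
  have he2 : Torus.ensembleEnergy μ < F / (4 * (G + 1)) := hlt.trans_le (min_le_right _ _)
  have hs1 : Real.sqrt (Torus.ensembleEnergy μ) ≤ 1 := by
    calc Real.sqrt (Torus.ensembleEnergy μ) ≤ Real.sqrt 1 := Real.sqrt_le_sqrt he1.le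
      _ = 1 := Real.sqrt_one
  -- the viscous term is `< F/4`
  have hA : ν * Real.sqrt (∫ x, ‖Torus.laplacian (Torus.fourierTruncate N f) x‖ ^ 2) *
      Real.sqrt (Torus.ensembleEnergy μ) ≤ F / (4 * (L + 1)) * L := by
    calc ν * Real.sqrt (∫ x, ‖Torus.laplacian (Torus.fourierTruncate N f) x‖ ^ 2) *
          Real.sqrt (Torus.ensembleEnergy μ) ≤ ν * L * 1 :=
          mul_le_mul (mul_le_mul_of_nonneg_left hsqrtL hν.le) hs1 (Real.sqrt_nonneg _)
            (mul_nonneg hν.le hL0)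
      _ = ν * L := mul_one _
      _ ≤ F / (4 * (L + 1)) * L := mul_le_mul_of_nonneg_right hνν₀ hL0
  have hL1 : L + 1 ≠ 0 := by positivity
  have hA' : F / (4 * (L + 1)) * L < F / 4 := by
    have h1 : F / (4 * (L + 1)) * L < F / (4 * (L + 1)) * (L + 1) :=
      mul_lt_mul_of_pos_left (lt_add_one L) (by positivity)
    have h2 : F / (4 * (L + 1)) * (L + 1) = F / 4 := by rw [← div_div, div_mul_cancel₀ _ hL1]
    linarith
  -- the inertial term is `≤ F/4`
  have hG1 : G + 1 ≠ 0 := by positivity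
  have hB : G * Torus.ensembleEnergy μ ≤ F / 4 := by
    have h1 : G * Torus.ensembleEnergy μ ≤ G * (F / (4 * (G + 1))) := mul_le_mul_of_nonneg_left he2.le hG0
    have h2 : G * (F / (4 * (G + 1))) ≤ (G + 1) * (F / (4 * (G + 1))) :=
      mul_le_mul_of_nonneg_right (by linarith) (by positivity)
    have h3 : (G + 1) * (F / (4 * (G + 1))) = F / 4 := by rw [mul_comm, ← div_div, div_mul_cancel₀ _ hG1]
    linarith
  linarith

end Summit.AnomalousDissipation.AnomalousDissipation.Theorems.GalerkinInvariantLoud.EnergyFloor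

end
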